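import Summits.HubbardSuperconductivity.HubbardSuperconductivity.Theses.ParityGapRigidity
import Literature.MathematicalPhysics.QuantumLattice.HubbardParityGapDoublonDeficit
import HarnessLib

/-!
# Route ParityGapRigidity — crux `GappedWindow` (stmt-HubbardSuperconductivity-2196):
# a uniform parity gap forces (coupling × doublon deficit) ≥ (2Δ × momentum smearing)

Helper file (`--supports stmt-HubbardSuperconductivity-2198`, the route's kill criterion, which has no
registered stubs; periphery of the crux stmt-2196, line `registered`, lead c6). A NECESSARY
condition on the window of the crux
`Summit.HubbardSuperconductivity.HubbardSuperconductivity.Theses.ParityGapRigidity.GappedWindow`,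
from the exact mode identity of `Literature/…/HubbardParityGapDoublonDeficit.lean`
(`parityGap_mul_smearing_le_of_isGroundStateInSector`: for EVERY unit `(2n, S^z=0)`-sector ground
state `ψ` of `hubbardTorus 2 L 1 U`, `L ≥ 3`, any real `U`,
`PG · Σ_k n_k(1-n_k) ≤ U · (n²/L² - Re⟨ψ, Σ_z n_{z↑}n_{z↓} ψ⟩)`, `PG = E(2n+1) + E(2n-1) - 2E₀(2n,0)`,
`n_k = ‖c_{k↑}ψ‖²`):

* `doublonDeficit_of_parityGap_clause` — the (PG) clause of `GappedWindow` at `(U, δ)`, verbatim,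
  gives `Δ > 0` and `L₀` such that every normalised `(N_L, 0)`-sector ground state at even `L ≥ L₀`
  obeys `2Δ · Σ_k n_k(1-n_k) ≤ U · (n_L²/L² - ⟨D⟩_ψ)`, `N_L = 2n_L = 2⌊(1-δ)L²/2⌋`,
  `D = Σ_z n_{z↑}n_{z↓}`;
* `gappedWindow_doublonDeficit` — the crux BY NAME ⇒ the same in its window;
* `not_parityGap_clause_of_smallDeficit` — **contrapositive, a sufficient condition for the kill
  criterion** `NoUniformParityGap` (stmt-2198) at one point `(U, δ)`: if for every `ε > 0` and every
  threshold some even side beyond it carries a normalised `(N_L, 0)`-sector ground state with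
  `U · (doublon deficit) < ε · (momentum smearing)`, the model has NO `L`-uniform parity gap there;
  `not_gappedWindow_of_forall_smallDeficit` — the same at every `(U, δ)` refutes `GappedWindow`.

Reading for planners/refuters. A window of the pure repulsive model is necessarily CORRELATED in
the two cheapest bulk observables at once: per site, `u·d ≥ 2Δ·s` with `d = n_L²/L⁴ - ⟨D⟩/L²` the
doublon deficit below the uncorrelated value and `s = L⁻²Σ_k n_k(1-n_k)` the momentum smearing
(both `O(1)`, both fast-converging in `L`, both routinely measured). With lead c5's no-Fermi-jump
condition (`ParityGapRigidityMomentumDistribution`) the smearing of a window is itself bounded below,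
so the window's doublon deficit per site is bounded below by a positive constant: no parity gap
without interaction-induced local correlation. At the Kohn–Luttinger candidate `d ~ U`, `s ~ ρΔ`
and `Δ ~ e^{-1/λ}`, so the condition is satisfied with room to spare — like every decidable
statement about this crux it calibrates the clause, it does not touch the open stub S of the line
(see `Cruxes/GappedWindow/Lines/registered-dead.md`).

No definitions. Reused: `parityGap_mul_smearing_le_of_isGroundStateInSector`, `smearing_nonneg`
(`HubbardParityGapDoublonDeficit`). Sources: Matveev–Larkin, PRL 78 (1997) 3749 (parity gap);
Tasaki (2020) §2.1, §9.3 (variational principle, Hubbard commutators); folklore.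
-/

noncomputable section

-- the mandated namespace `Summit.<Summit>.<Problem>.Theorems` repeats `HubbardSuperconductivity`
-- (single-problem summit, D-0017), which the `dupNamespace` linter flags on every declaration
set_option linter.dupNamespace false

namespace Summit.HubbardSuperconductivity.HubbardSuperconductivity.Theorems

open Summit.HubbardSuperconductivity.HubbardSuperconductivity.Theses.ParityGapRigidity
open Literature.MathematicalPhysics.QuantumLattice Literature.Probability.LatticeModels Matrix

/-- **The (PG) clause of `GappedWindow` at `(U, δ)`, verbatim, forces coupling × doublon deficit
≥ 2Δ × momentum smearing** in every normalised `(N_L, S^z = 0)`-sector ground state of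
`hubbardTorus 2 L 1 U` at even `L ≥ L₀`, `N_L = 2⌊(1-δ)L²/2⌋`:
`2Δ · Σ_k n_k(1 - n_k) ≤ U · (⌊(1-δ)L²/2⌋² / L² - Re⟨ψ, Σ_z n_{z↑}n_{z↓} ψ⟩)`, `n_k = ‖c_{k↑}ψ‖²`. -/
theorem doublonDeficit_of_parityGap_clause (U δ : ℝ)
    (hPG : ∃ Δ : ℝ, 0 < Δ ∧ ∃ L₀ : ℕ, ∀ L ≥ L₀, Even L → ∀ Hm, Hm = hubbardTorus 2 L 1 U →
      2 * Δ ≤ groundEnergy Hm (2 * ⌊(1 - δ) * (L : ℝ) ^ 2 / 2⌋₊ + 1) +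
        groundEnergy Hm (2 * ⌊(1 - δ) * (L : ℝ) ^ 2 / 2⌋₊ - 1) -
        2 * Matrix.minEnergyOn Hm (szSector (2 * ⌊(1 - δ) * (L : ℝ) ^ 2 / 2⌋₊) 0)) :
    ∃ Δ : ℝ, 0 < Δ ∧ ∃ L₀ : ℕ, ∀ (L : ℕ) [NeZero L], L₀ ≤ L → Even L →
      ∀ ψ : Fock (Orb (FermionTorus 2 L)),
        IsGroundStateInSector (hubbardTorus 2 L 1 U) (2 * ⌊(1 - δ) * (L : ℝ) ^ 2 / 2⌋₊) 0 ψ →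
        star ψ ⬝ᵥ ψ = 1 →
        2 * Δ * ∑ k : TorusSite 2 L,
            (star (momentumAnnihilation k 0 *ᵥ ψ) ⬝ᵥ (momentumAnnihilation k 0 *ᵥ ψ)).re *
              (1 - (star (momentumAnnihilation k 0 *ᵥ ψ) ⬝ᵥ (momentumAnnihilation k 0 *ᵥ ψ)).re) ≤
          U * (((⌊(1 - δ) * (L : ℝ) ^ 2 / 2⌋₊ : ℕ) : ℝ) ^ 2 / (L : ℝ) ^ 2 -
            (star ψ ⬝ᵥ ((∑ z : FermionTorus 2 L, numberOp z 0 * numberOp z 1) *ᵥ ψ)).re) := by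
  obtain ⟨Δ, hΔ, L₀, hgap⟩ := hPG
  refine ⟨Δ, hΔ, max L₀ 3, fun L _ hL hev ψ hgs hψ1 => ?_⟩
  have hL0 : L₀ ≤ L := le_of_max_le_left hL
  have hL3 : 3 ≤ L := le_of_max_le_right hL
  have hpg := hgap L hL0 hev _ rfl
  have hid := parityGap_mul_smearing_le_of_isGroundStateInSector hL3 U hgs hψ1
  have hs := smearing_nonneg (L := L) hψ1
  exact (mul_le_mul_of_nonneg_right hpg hs).trans hid

/-- **`GappedWindow` ⇒ coupling × doublon deficit ≥ 2Δ × momentum smearing in its window.** The crux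
BY NAME yields `U > 0`, `δ ∈ (0, 1/2)`, `Δ > 0` and `L₀` such that every normalised
`(N_L, 0)`-sector ground state at even `L ≥ L₀` has
`2Δ · Σ_k n_k(1 - n_k) ≤ U · (⌊(1-δ)L²/2⌋² / L² - ⟨Σ_z n_{z↑}n_{z↓}⟩_ψ)`: a window is correlated —
its doublon number lies below the uncorrelated value by at least `(2Δ/U)` times its momentum
smearing. -/
theorem gappedWindow_doublonDeficit (hW : GappedWindow) :
    ∃ U : ℝ, 0 < U ∧ ∃ δ ∈ Set.Ioo (0 : ℝ) (1 / 2), ∃ Δ : ℝ, 0 < Δ ∧ ∃ L₀ : ℕ,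
      ∀ (L : ℕ) [NeZero L], L₀ ≤ L → Even L →
        ∀ ψ : Fock (Orb (FermionTorus 2 L)),
          IsGroundStateInSector (hubbardTorus 2 L 1 U) (2 * ⌊(1 - δ) * (L : ℝ) ^ 2 / 2⌋₊) 0 ψ →
          star ψ ⬝ᵥ ψ = 1 →
          2 * Δ * ∑ k : TorusSite 2 L,
              (star (momentumAnnihilation k 0 *ᵥ ψ) ⬝ᵥ (momentumAnnihilation k 0 *ᵥ ψ)).re *
                (1 - (star (momentumAnnihilation k 0 *ᵥ ψ) ⬝ᵥ (momentumAnnihilation k 0 *ᵥ ψ)).re) ≤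
            U * (((⌊(1 - δ) * (L : ℝ) ^ 2 / 2⌋₊ : ℕ) : ℝ) ^ 2 / (L : ℝ) ^ 2 -
              (star ψ ⬝ᵥ ((∑ z : FermionTorus 2 L, numberOp z 0 * numberOp z 1) *ᵥ ψ)).re) := by
  obtain ⟨U, hU, δ, hδ, hPG, -⟩ := hW
  obtain ⟨Δ, hΔ, L₀, h⟩ := doublonDeficit_of_parityGap_clause U δ hPG
  exact ⟨U, hU, δ, hδ, Δ, hΔ, L₀, h⟩

/-- **A doublon deficit that is small against the momentum smearing refutes the (PG) clause**
(sufficient condition for the kill criterion `NoUniformParityGap`, stmt-2198, at one point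
`(U, δ)`): if for every `ε > 0` and every threshold `L₀` some even side `L ≥ L₀` carries a normalised
`(N_L, 0)`-sector ground state of `hubbardTorus 2 L 1 U` with
`U · (⌊(1-δ)L²/2⌋²/L² - ⟨Σ_z n_{z↑}n_{z↓}⟩_ψ) < ε · Σ_k n_k(1 - n_k)`, then the model has NO
`L`-uniform parity gap at `(U, δ)`. Proof: a parity gap `2Δ` would give the reverse inequality with
`ε = 2Δ` at every large even side. -/
theorem not_parityGap_clause_of_smallDeficit (U δ : ℝ)
    (hsmall : ∀ ε : ℝ, 0 < ε → ∀ L₀ : ℕ, ∃ (L : ℕ) (_ : NeZero L), L₀ ≤ L ∧ Even L ∧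
      ∃ ψ : Fock (Orb (FermionTorus 2 L)),
        IsGroundStateInSector (hubbardTorus 2 L 1 U) (2 * ⌊(1 - δ) * (L : ℝ) ^ 2 / 2⌋₊) 0 ψ ∧
        star ψ ⬝ᵥ ψ = 1 ∧
        U * (((⌊(1 - δ) * (L : ℝ) ^ 2 / 2⌋₊ : ℕ) : ℝ) ^ 2 / (L : ℝ) ^ 2 -
            (star ψ ⬝ᵥ ((∑ z : FermionTorus 2 L, numberOp z 0 * numberOp z 1) *ᵥ ψ)).re) <
          ε * ∑ k : TorusSite 2 L,
            (star (momentumAnnihilation k 0 *ᵥ ψ) ⬝ᵥ (momentumAnnihilation k 0 *ᵥ ψ)).re *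
              (1 - (star (momentumAnnihilation k 0 *ᵥ ψ) ⬝ᵥ (momentumAnnihilation k 0 *ᵥ ψ)).re)) :
    ¬ (∃ Δ : ℝ, 0 < Δ ∧ ∃ L₀ : ℕ, ∀ L ≥ L₀, Even L → ∀ Hm, Hm = hubbardTorus 2 L 1 U →
      2 * Δ ≤ groundEnergy Hm (2 * ⌊(1 - δ) * (L : ℝ) ^ 2 / 2⌋₊ + 1) +
        groundEnergy Hm (2 * ⌊(1 - δ) * (L : ℝ) ^ 2 / 2⌋₊ - 1) -
        2 * Matrix.minEnergyOn Hm (szSector (2 * ⌊(1 - δ) * (L : ℝ) ^ 2 / 2⌋₊) 0)) := by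
  intro hPG
  obtain ⟨Δ, hΔ, L₀, hdef⟩ := doublonDeficit_of_parityGap_clause U δ hPG
  obtain ⟨L, hLne, hL, hev, ψ, hgs, hψ1, hlt⟩ := hsmall (2 * Δ) (by positivity) L₀
  have hge := hdef L hL hev ψ hgs hψ1
  linarith

/-- **A small doublon deficit at every `(U, δ)` refutes `GappedWindow`** (the crux BY NAME): if at
every `U > 0`, `δ ∈ (0, 1/2)` the `(N_L, 0)`-sector ground states keep `U · deficit < ε · smearing` for
every `ε > 0` along infinitely many even `L`, the window does not exist. -/
theorem not_gappedWindow_of_forall_smallDeficit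
    (hsmall : ∀ (U δ : ℝ), 0 < U → δ ∈ Set.Ioo (0 : ℝ) (1 / 2) →
      ∀ ε : ℝ, 0 < ε → ∀ L₀ : ℕ, ∃ (L : ℕ) (_ : NeZero L), L₀ ≤ L ∧ Even L ∧
        ∃ ψ : Fock (Orb (FermionTorus 2 L)),
          IsGroundStateInSector (hubbardTorus 2 L 1 U) (2 * ⌊(1 - δ) * (L : ℝ) ^ 2 / 2⌋₊) 0 ψ ∧
          star ψ ⬝ᵥ ψ = 1 ∧
          U * (((⌊(1 - δ) * (L : ℝ) ^ 2 / 2⌋₊ : ℕ) : ℝ) ^ 2 / (L : ℝ) ^ 2 -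
              (star ψ ⬝ᵥ ((∑ z : FermionTorus 2 L, numberOp z 0 * numberOp z 1) *ᵥ ψ)).re) <
            ε * ∑ k : TorusSite 2 L,
              (star (momentumAnnihilation k 0 *ᵥ ψ) ⬝ᵥ (momentumAnnihilation k 0 *ᵥ ψ)).re *
                (1 - (star (momentumAnnihilation k 0 *ᵥ ψ) ⬝ᵥ (momentumAnnihilation k 0 *ᵥ ψ)).re)) :
    ¬ GappedWindow := by
  rintro ⟨U, hU, δ, hδ, hPG, -⟩
  exact not_parityGap_clause_of_smallDeficit U δ (hsmall U δ hU hδ) hPG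

end Summit.HubbardSuperconductivity.HubbardSuperconductivity.Theorems

end
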